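import Summits.QuantumAdvantage.AdviceFreeQNC0.AdviceFreeQNC0
import Summits.QuantumAdvantage.AdviceFreeQNC0.RingHardOdd
import Summits.QuantumAdvantage.AdviceFreeQNC0.RingKernel
import Summits.QuantumAdvantage.AdviceFreeQNC0.RingSymmetry
import Literature.Computability.MetaComplexity.LowDegreeComposition
import HarnessLib

/-!
# RingPeriodFold — periodic patterns FOLD the ring game `Rel(C_n)` (cell decomp-qadv, lens 2 g7 «PeriodDial», tree twin)

Support library (sorry-free, standard axioms) extracted from the node `HOME/decomp-qadv-lens-2/g7/PeriodDial.lean` for landing as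
`--kind proof --supports stmt-QuantumAdvantage-27432 27380` (helper; closes no item).  Contents: periodization `per m y` of a pattern of
the `d`-ring to the `m·d`-ring and, for `m` odd, `d ≥ 3`, `y` in the odd class: `oddZeros_per_iff`, `kvec_per` (kernel vector folds),
`wtAnd_even_of_inKernel`, **`rel_per_per_iff : Rel (per m y) (per m w) ↔ Rel y w`**; covariant rules `cov Q` / `d`-equivariant strategies
answer periodic patterns by their FOLD of the same degree (`cov_per`, `eqv_output_per`, `foldQ_mem_lowDeg`); DESCENT of perfection
`covPerfect_fold`, AMPLIFIER `covNotPerfectAt_mul`, EQUIVARIANT FOLD `notPerfect_eqv_mul`; the laws `covNotPerfect_iff_irr`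
(covariant non-perfection need only be checked at fold-irreducible lengths) and `notPerfect_iff_aperiodic` («WLOG aperiodic», every
degree `D`; `NotPerfect 2` is ExactnessDial's `NoPerfectTwo3` and `∀ D, NotPerfect D` its `NoPerfectConst3`, by `Iff.rfl` on the bodies);
`decide` certificate `allOnes_perfect_three` (the 3-ring is solved on its odd class by `z ≡ 1`).  Not in print.
-/

noncomputable section

set_option linter.dupNamespace false

namespace Summit.QuantumAdvantage.QuantumAdvantage.Theorems.RingPeriodFold

open Finset Literature.Computability.QuantumComplexity Literature.Computability.QuantumComplexity.RingHLF
open Literature.Computability.MetaComplexity Literature.Computability.MetaComplexity.Smolensky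
open Summit.QuantumAdvantage.AdviceFreeQNC0

open scoped Classical

/-! ## §1 Periodization of patterns and the counting lemma -/

variable {m d : ℕ}

/-- the `m`-fold PERIODIC pattern `per y : Fin (m·d) → Bool`, `(per y)_b = y_{b mod d}`. -/
def per (m : ℕ) (y : Fin d → Bool) : Fin (m * d) → Bool := fun b => y b.modNat

/-- `per m y b = y (b mod d)` (definitional). -/
theorem per_apply (y : Fin d → Bool) (b : Fin (m * d)) : per m y b = y b.modNat := rfl

/-- the residue of the position `(c, i)` of the `m·d`-ring is `i`. -/
theorem modNat_finProdFinEquiv (c : Fin m) (i : Fin d) : (finProdFinEquiv (c, i)).modNat = i := by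
  have h := finProdFinEquiv.symm_apply_apply (c, i)
  rw [finProdFinEquiv_symm_apply] at h
  exact congrArg Prod.snd h

/-- `per m y` at position `(c, i)` is `y i`. -/
theorem per_finProdFinEquiv (y : Fin d → Bool) (c : Fin m) (i : Fin d) : per m y (finProdFinEquiv (c, i)) = y i := by
  rw [per_apply, modNat_finProdFinEquiv]

/-- counting along the fibres of `b ↦ b mod d`: a predicate of `b mod d` holds at `m · #{i | p i}` positions. -/
theorem card_filter_modNat (p : Fin d → Prop) [DecidablePred p] :
    (univ.filter fun b : Fin (m * d) => p b.modNat).card = m * (univ.filter p).card := by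
  rw [card_filter, card_filter]
  rw [← Fintype.sum_equiv finProdFinEquiv (fun ci : Fin m × Fin d => if p ci.2 then 1 else 0)
      (fun b : Fin (m * d) => if p b.modNat then 1 else 0) (fun ci => by rw [modNat_finProdFinEquiv])]
  rw [Fintype.sum_prod_type]
  show (∑ _c : Fin m, ∑ i : Fin d, if p i then 1 else 0) = _
  rw [sum_const, card_univ, Fintype.card_fin, smul_eq_mul]

/-- `(b + k) mod (m d) mod d = (b mod d + k) mod d`. -/
theorem mod_helper (b k : ℕ) : (b + k) % (m * d) % d = (b % d + k) % d := by
  rw [Nat.mod_mul_left_mod, Nat.add_mod, Nat.add_mod (b % d) k, Nat.mod_mod]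

/-- the residue of the successor is the successor of the residue. -/
theorem modNat_nxt (b : Fin (m * d)) : (nxt b).modNat = nxt b.modNat := by
  apply Fin.ext
  simp only [Fin.modNat, nxt]
  exact mod_helper b.val 1

/-- the residue of the predecessor is the predecessor of the residue. -/
theorem modNat_prv (b : Fin (m * d)) : (prv b).modNat = prv b.modNat := by
  have h := modNat_nxt (prv b)
  rw [nxt_prv] at h
  rw [h, prv_nxt]

/-- rotation commutes with periodization. -/
theorem rot_per (k : ℕ) (y : Fin d → Bool) : rot k (per m y) = per m (rot k y) := by
  funext b
  simp only [rot, per_apply, Fin.modNat]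
  congr 1
  apply Fin.ext
  exact mod_helper b.val k

/-- odd number of zeros is preserved by an odd-fold periodization. -/
theorem oddZeros_per_iff (hm : Odd m) (y : Fin d → Bool) : OddZeros (per m y) ↔ OddZeros y := by
  unfold OddZeros
  rw [show (univ.filter fun b : Fin (m * d) => per m y b = false) = univ.filter fun b : Fin (m * d) => y b.modNat = false
      from rfl, card_filter_modNat (fun i => y i = false), Nat.mul_mod, Nat.odd_iff.mp hm, one_mul, Nat.mod_mod]

/-! ## §2 The ring kernel and the game FOLD along periodization -/

/-- kernel vectors periodize: `InKernel y v → InKernel (per m y) (per m v)`. -/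
theorem inKernel_per (y v : Fin d → Bool) (h : InKernel y v) : InKernel (per m y) (per m v) := by
  intro b
  simp only [per_apply, modNat_nxt, modNat_prv]
  exact h b.modNat

/-- the edge count of a periodized vector is `m` times that of the period. -/
theorem edgesIn_per (v : Fin d → Bool) : edgesIn (per m v) = m * edgesIn v := by
  unfold edgesIn
  rw [← card_filter_modNat (m := m) (fun i => v i = true ∧ v (nxt i) = true)]
  congr 1
  ext b
  simp only [mem_filter, mem_univ, true_and, per_apply, modNat_nxt]

/-- the AND-weight periodizes multiplicatively: `wtAnd (per m y) (per m v) = m · wtAnd y v`. -/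
theorem wtAnd_per (y v : Fin d → Bool) : wtAnd (per m y) (per m v) = m * wtAnd y v := by
  unfold wtAnd
  exact card_filter_modNat (m := m) (fun i => y i = true ∧ v i = true)

/-- multiplying by an odd number preserves parity. -/
theorem mul_mod_two_of_odd (hm : Odd m) (a : ℕ) : m * a % 2 = a % 2 := by
  rw [Nat.mul_mod, Nat.odd_iff.mp hm, one_mul, Nat.mod_mod]

/-- for odd `m` the `𝔽₂` pairing is fold-invariant: `dot2 (per m v) (per m w) = dot2 v w`. -/
theorem dot2_per (hm : Odd m) (v w : Fin d → Bool) : dot2 (per m v) (per m w) = dot2 v w := by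
  unfold dot2
  rw [show (univ.filter fun b : Fin (m * d) => per m v b = true ∧ per m w b = true) =
      univ.filter fun b : Fin (m * d) => v b.modNat = true ∧ w b.modNat = true from rfl,
    card_filter_modNat (fun i => v i = true ∧ w i = true), mul_mod_two_of_odd hm]

/-- on a kernel vector the overlap `|x ∧ v|` is EVEN: in `𝔽₂`, `Σ_b x_b v_b = Σ_b (v_{b-1} + v_{b+1}) = 2·Σ v = 0`. -/
theorem wtAnd_even_of_inKernel {n : ℕ} (x v : Fin n → Bool) (h : InKernel x v) : Even (wtAnd x v) := by
  have key : ∀ b : Fin n, (if (x b = true ∧ v b = true) then (1 : ZMod 2) else 0) =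
      (if v (prv b) = true then (1 : ZMod 2) else 0) + (if v (nxt b) = true then 1 else 0) := by
    intro b
    have hb := h b
    revert hb
    cases x b <;> cases v b <;> cases v (prv b) <;> cases v (nxt b) <;> decide
  have hsum : ((wtAnd x v : ℕ) : ZMod 2) = 0 := by
    unfold wtAnd
    rw [card_filter, Nat.cast_sum]
    simp only [Nat.cast_ite, Nat.cast_one, Nat.cast_zero]
    rw [Finset.sum_congr rfl fun b _ => key b, sum_add_distrib]
    have hprv : ∑ b : Fin n, (if v (prv b) = true then (1 : ZMod 2) else 0) = ∑ b : Fin n, (if v b = true then (1 : ZMod 2) else 0) :=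
      Fintype.sum_bijective prv (Finite.injective_iff_bijective.mp prv_injective) _ _ (fun _ => rfl)
    have hnxt : ∑ b : Fin n, (if v (nxt b) = true then (1 : ZMod 2) else 0) = ∑ b : Fin n, (if v b = true then (1 : ZMod 2) else 0) :=
      Fintype.sum_bijective nxt (Finite.injective_iff_bijective.mp nxt_injective) _ _ (fun _ => rfl)
    rw [hprv, hnxt]
    generalize (∑ b : Fin n, (if v b = true then (1 : ZMod 2) else 0)) = s
    have : s + s = 2 * s := by ring
    rw [this, show (2 : ZMod 2) = 0 from rfl, zero_mul]
  exact (ZMod.natCast_eq_zero_iff_even).mp hsum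

/-- for odd `m` and even `wtAnd y v` the sign bit is fold-invariant. -/
theorem signBit_per (hm : Odd m) (y v : Fin d → Bool) (hev : Even (wtAnd y v)) :
    signBit (per m y) (per m v) = signBit y v := by
  unfold signBit
  rw [edgesIn_per, wtAnd_per]
  obtain ⟨u, hu⟩ := hev
  rw [hu, ← two_mul, Nat.mul_left_comm, Nat.mul_div_cancel_left _ two_pos, Nat.mul_div_cancel_left _ two_pos, ← Nat.mul_add,
    mul_mod_two_of_odd hm]

/-- with a two-element kernel `{0, V}` the ring relation is ONE parity constraint. -/
theorem rel_iff_of_kernel_pair {n : ℕ} (x V z : Fin n → Bool)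
    (hK : ∀ v, InKernel x v ↔ v = (fun _ => false) ∨ v = V) : Rel x z ↔ dot2 V z = signBit x V := by
  constructor
  · intro h; exact h V ((hK V).mpr (Or.inr rfl))
  · intro h v hv
    rcases (hK v).mp hv with rfl | rfl
    · simp [dot2, signBit, edgesIn, wtAnd]
    · exact h

/-- the canonical kernel vector of an odd pattern (tree `kernel_odd`). -/
def kvec {n : ℕ} (x : Fin n → Bool) : Fin n → Bool := kernelVec x (fixVec (sigmaSum (List.ofFn x)))

/-- odd-class patterns have reflection bit `true` (tree `reflBit_ofFn_iff`). -/
theorem reflBit_of_oddZeros {n : ℕ} {x : Fin n → Bool} (hx : OddZeros x) : reflBit (List.ofFn x) = true := by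
  rw [reflBit_ofFn_iff, Nat.odd_iff]; exact hx

/-- on the odd class (`n ≥ 3`) the kernel of `x` is exactly `{0, kvec x}` (tree `kernel_odd`). -/
theorem kernel_pair_of_oddZeros {n : ℕ} (hn : 3 ≤ n) {x : Fin n → Bool} (hx : OddZeros x) (v : Fin n → Bool) :
    InKernel x v ↔ v = (fun _ => false) ∨ v = kvec x := kernel_odd hn x (reflBit_of_oddZeros hx) v

/-- the canonical kernel vector of an odd-class pattern is nonzero. -/
theorem kvec_ne_zero {n : ℕ} (hn : 3 ≤ n) {x : Fin n → Bool} (hx : OddZeros x) : kvec x ≠ fun _ => false :=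
  kernelVec_fixVec_ne_zero hn x (reflBit_of_oddZeros hx)

/-- an odd number is at least `1`. -/
theorem one_le_of_odd (hm : Odd m) : 1 ≤ m := by obtain ⟨t, rfl⟩ := hm; omega

/-- the kernel vector of a periodic odd pattern is the periodization of the kernel vector. -/
theorem kvec_per (hm : Odd m) (hd : 3 ≤ d) {y : Fin d → Bool} (hy : OddZeros y) : kvec (per m y) = per m (kvec y) := by
  have hmd : 3 ≤ m * d := le_trans hd (Nat.le_mul_of_pos_left d (one_le_of_odd hm))
  have hy' : OddZeros (per m y) := (oddZeros_per_iff hm y).mpr hy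
  have hin : InKernel (per m y) (per m (kvec y)) :=
    inKernel_per y (kvec y) (((kernel_pair_of_oddZeros hd hy) _).mpr (Or.inr rfl))
  rcases ((kernel_pair_of_oddZeros hmd hy') _).mp hin with h0 | h1
  · exfalso
    apply kvec_ne_zero hd hy
    funext i
    have := congrFun h0 (finProdFinEquiv (⟨0, one_le_of_odd hm⟩, i))
    rwa [per_finProdFinEquiv] at this
  · exact h1.symm

/-- **FOLD LAW (periodic patterns fold the ring game).**  For `m` odd, `d ≥ 3`, `y` in the odd class of the `d`-ring
and any `w`: `Rel (per y) (per w) ↔ Rel y w` on the `m·d`-ring vs the `d`-ring. -/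
theorem rel_per_per_iff (hm : Odd m) (hd : 3 ≤ d) {y : Fin d → Bool} (hy : OddZeros y) (w : Fin d → Bool) :
    Rel (per m y) (per m w) ↔ Rel y w := by
  have hmd : 3 ≤ m * d := le_trans hd (Nat.le_mul_of_pos_left d (one_le_of_odd hm))
  have hy' : OddZeros (per m y) := (oddZeros_per_iff hm y).mpr hy
  rw [rel_iff_of_kernel_pair _ _ _ (kernel_pair_of_oddZeros hmd hy'),
    rel_iff_of_kernel_pair _ _ _ (kernel_pair_of_oddZeros hd hy), kvec_per hm hd hy, dot2_per hm,
    signBit_per hm _ _ (wtAnd_even_of_inKernel _ _ (((kernel_pair_of_oddZeros hd hy) _).mpr (Or.inr rfl)))]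

end Summit.QuantumAdvantage.QuantumAdvantage.Theorems.RingPeriodFold
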